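import Summits.AnomalousDissipation.AnomalousDissipation.Theses.DecimationAxis

/-!
# Birth skeleton (BC3) — crux `DecimationAxis.GalerkinFloor` (stmt-AnomalousDissipation-1582)

Route `AnomalousDissipation/DecimationAxis` (route-AnomalousDissipation-DecimationAxis), item
stmt-AnomalousDissipation-1582, crux rank 2 (the physics of the route); skeleton registrar
planner-skel-stmt-AnomalousDissipation-1582-0, 2026-08-17.

The crux (`Summit.AnomalousDissipation.AnomalousDissipation.Theses.DecimationAxis.GalerkinFloor`): SOME
band-limited steady designer force `g` (real, supported in `freqBall N`, `g 0 = 0`, transversal), budgets `E`,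
`ε > 0` and viscosities `ν_j → 0⁺` such that for every `j` there are a RESOLUTION WAVENUMBER `M` and a truncation
threshold `K₀` with: for EVERY `K ≥ K₀` some trajectory of the exact-coupling Galerkin system `galerkinRHS` on
`S = freqBall K ∖ {0}` at viscosity `ν_j` has `limsup`-mean energy `≤ E` and `liminf`-mean RESOLVED dissipation
`ν_j·4π²·Σ_{|k| ≤ M} |k|²‖c_k‖² ≥ 2ε`.  The two uniformities (in `K`, and `M = M(j)` independent of `K`) are the
whole content.

## The line of this skeleton: THE DISSIPATION SEAM — `ν → 0` anomaly × fixed-`ν` resolution (two registered stubs)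

The resolved dissipation below `M` is the TOTAL dissipation `ν‖∇u‖²` minus the enstrophy tail carried by the modes
`|k| > M`; by the exact Galerkin energy balance (tree: `sum_re_inner_galerkinField_self`) the long-time mean of the
total dissipation is the mean injection `⟨Σ Re⟨g_k, c_k⟩⟩`.  The crux therefore factors through exactly one seam,
and the two factors are two DIFFERENT open problems:

* `stub_uniformGalerkinAnomaly` (HEART, XL, open — the `ν → 0` physics): the crux with the resolution clause
  removed — SOME designer force, budgets, `ν_j → 0⁺` such that for every `j`, EVENTUALLY IN THE TRUNCATION `K`,
  some Galerkin trajectory on `freqBall K ∖ {0}` has `limsup`-mean energy `≤ E` and `liminf`-mean TOTAL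
  dissipation `≥ ε`.  This is the truncation-uniform zeroth law for converged Galerkin dynamics ("the DNS plateau",
  KanedaEtAl2003: `εL/u′³ ≈ 0.4–0.5`, resolution-independent once `k_max η ≳ 1`; Sreenivasan1998), in
  trajectory / time-average form and EVENTUALLY in `K` — the trajectory shadow of the ensemble crux
  `MomentParity.GalerkinInvariantLoud` (stmt-AnomalousDissipation-14283: loud Galerkin-INVARIANT LAWS, frequently in
  `N`; Krylov–Bogoliubov turns a witness of this stub at level `K` into such a law — a remark, not used here).
  NECESSARY: `GalerkinFloor ⟹ stub 1` (resolved ≤ total, `liminf` monotone).  NOT SUFFICIENT and NOT THE SUMMIT: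
  total dissipation is only lower semicontinuous along `K → ∞` (FoiasManleyRosaTemam2001 Ch. IV (1.31)–(1.33):
  Galerkin-limit stationary statistics carry the mean energy INEQUALITY only), so stub 1 alone reaches neither the
  crux (no `K`-independent `M`) nor `ZerothLaw` — that gap is precisely stub 2.
  WHY IT MIGHT FAIL: the zeroth law may fail for every steady band-limited force (laminar / condensate branches;
  Marchioro-type rigidity is proved AT EVERY TRUNCATION for gravest-mode planar forcing, tree
  `Barriers/GravestModeLaminarAttractorGalerkin`, so `g` must be genuinely three-dimensional), or hold only with
  `K`-dependent budgets.  Sources: KanedaEtAl2003, Sreenivasan1998, Frisch1995 §5.2, FoiasManleyRosaTemam2001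
  Ch. IV–V, DoeringFoias2002 §2; hub: stmt-AnomalousDissipation-14283.
* `stub_fixedViscosityResolution` (L–XL, open, regularity-flavoured — the `K → ∞` analysis at FIXED `ν`): for
  every `ν > 0`, designer force `(N, g)`, budgets `E`, `ε` and loss `δ > 0` there is ONE wavenumber `M` such that
  for EVERY truncation `K` and EVERY Galerkin trajectory on `freqBall K ∖ {0}` with `limsup`-mean energy `≤ E` and
  `liminf`-mean total dissipation `≥ ε`, the `liminf`-mean RESOLVED dissipation below `M` is `≥ ε − δ`: loud
  bounded Galerkin dynamics at fixed viscosity do not leak a fixed fraction of their time-averaged dissipation to the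
  truncation scale as `K → ∞` (dissipation spectrum tight in `k` uniformly in `K`; physically cut off at
  `k_η(ν) = (ε/ν³)^{1/4}`, K41).  Equivalently (Krylov–Bogoliubov at level `K`, then Step 1 of
  `Cruxes/ResolvedDissipation/WhyItResists.md`): every weak-* limit `K → ∞` of loud invariant Galerkin laws at
  `(g, ν)` satisfies the MEAN ENERGY EQUALITY `ν⟨‖∇u‖²⟩ = ⟨(f, u)⟩` instead of FMRT's inequality.  It is implied by
  the ensemble crux `MomentParity.ResolvedDissipation` (stmt-AnomalousDissipation-14284) for `f = realTrigPoly g`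
  (all invariant laws of the truncations live in the `K`-uniform absorbing ball), hence by global regularity of
  `NS(ν, f)` on `T³` (ibid. Step 4: a failure forces statistically persistent finite-time blow-up from a recurrent
  set of `V`-data — a NEGATIVE solution of the forced periodic regularity problem); it is strictly weaker than
  regularity and plausibly as hard as Leray–Hopf energy equality in the statistically stationary regime.  Known
  `K`-uniform inputs: mean enstrophy `ν⟨‖∇u‖²⟩ = ⟨(f,u)⟩ ≤ ‖f‖√E` (energy row) and the Foias–Guillopé–Temam bound
  `⟨|Au|^{2/3}⟩ ≤ c` (FoiasGuillopeTemam1981; FMRT IV (3.6)) — an `H²`-moment of order `2/3` does not control the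
  tail of the quadratic quantity; the open part is UNIFORM INTEGRABILITY IN TIME of the enstrophy along loud
  trajectories, uniformly in `K` (the ensemble criterion `exists_isResolved_of_uniformlyIntegrable_of_weightedH2` of
  `Cruxes/UniformResolution/Disproof.lean`, whose weighted-`H²` half is PROVED there, transposes verbatim).
  NOT A COSTUME: universally quantified, at ONE fixed viscosity, no `ν → 0`, no existence claim — it gives neither
  the crux (no loud family) nor the summit; and it is not stub 1 reworded (stub 1 is existential along `ν_j → 0`).
  WHY IT MIGHT FAIL: intermittent enstrophy — a positive Duchon–Robert energy defect at positive viscosity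
  (DuchonRobert2000; energy equality is known only under Onsager-critical integrability,
  CheskidovConstantinFriedlanderShvydkoy2008 = arXiv:0704.0759) FORCED on the loud trajectories of some designer
  force; its numerical shadow is partial thermalisation / bottleneck pile-up at `k ~ K` in under-resolved truncated
  dynamics (CichowlasEtAl2005, FrischEtAl2008).  Sources: FoiasManleyRosaTemam2001 Ch. IV (1.31)–(1.33), (3.6);
  FoiasGuillopeTemam1981; FoiasRosaTemam2019 (= arXiv:1606.02174) §4 Def. 4.1, Rem. 4.1; DuchonRobert2000;
  arXiv:0704.0759; CichowlasEtAl2005; FrischEtAl2008; hub: stmt-AnomalousDissipation-14284, -14330 and their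
  `Cruxes/{ResolvedDissipation,UniformResolution}/Disproof.lean` (read 2026-08-17).

Composition `GalerkinFloor_of` (sorry-free bookkeeping + one line of arithmetic): keep the heart's
`(N, g, E, ν_j)`, take `ε_crux := ε/3`; at level `j` take `K₀` from stub 1 and `M` from stub 2 applied at
`(ν_j, N, g, E, ε, δ := ε/3)`; for `K ≥ K₀` the stub-1 trajectory satisfies stub 2's premises verbatim, whose
conclusion `ε − ε/3 ≤ liminf`-mean resolved dissipation is the crux's clause `2·(ε/3) ≤ …` — concluded BY NAME.
`GalerkinFloor_via_stubs : GalerkinFloor` is the skeleton in its final shape (depends on `sorryAx` through the two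
stubs only).

This is the route header's own TWO-LAYER PLAN ("GalerkinFloor ⇐ (K-uniform time-averaged enstrophy-flux identity
at wavenumber M) ∧ (injection persistence)") made checkable, with the flux clause in its honest open form: by the
high-mode energy balance the mean flux through `M` IS the mean tail dissipation, so "flux identity at `M`,
uniformly in `K`" = stub 2, and "injection persistence" = stub 1 read through the exact Galerkin balance
(mean injection = mean total dissipation on bounded trajectories).

Foreseen refinements (NOT registered; for the crux chain): stub 1 ⇐ (injection persistence
`liminf`-mean `Σ_{|k|≤N} Re⟨g_k, c_k⟩ ≥ ε`, open) ∧ (long-time-average Galerkin energy balance, provable: energy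
identity along `HasDerivWithinAt` solutions + boundedness); stub 2 ⇐ (`K`-uniform uniform-in-time integrability
of `t ↦ ‖∇u(t)‖²` on loud bounded trajectories at fixed `ν`, open) ∧ (weighted-`H²` time-average bound + spectral
Chebyshev, provable — the trajectory transcription of `fgt_integral_bound` / `tailGradNormSq_mul_le_eLapNormSq`);
stub 2 restricted to the STEADY / laminar sector is true outright (elliptic bootstrap, cf. `steadyDiracsResolved`).

## Disproof / negatives honoured

No `Cruxes/GalerkinFloor/Disproof.lean` exists (this file is the crux directory's first workfile, `ledger crux ls`
2026-08-17).  The standing disproof files of the two sibling cruxes this seam transposes were read and are honoured: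
`Cruxes/UniformResolution/Disproof.lean` §D load-bearing table — `ν > 0` and `ε > 0`/loss `> 0` are load-bearing
(`not_uniformResolutionWithoutEpsPos`; here: `0 < ν`, `0 < δ` kept in stub 2, `0 < ε` in stub 1), stationarity
must be used beyond degree-2 budgets (`not_uniformResolutionMeanRowOnly`: stub 2 is about genuine trajectories, all
rows available), the steady sector is resolved (consistent: stub 2 holds there); `Cruxes/ResolvedDissipation/
WhyItResists.md` — the universal fixed-`ν` resolution statement admits no cheap kill (¬ ⟹ forced NS blow-up with
persistent singular statistics), which is why the seam is cut with the resolution half UNIVERSAL rather than hidden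
inside the witness family.  Route barriers (`Marchioro1986_globalAttraction`, `AlexakisDoering2006_…`,
`Cheskidov2023_thm13_…`): inherited unchanged by stub 1 (∃ g, genuinely 3-D designer force; positive witness
statements are outside the force-robust no-anomaly class); none concerns stub 2 (fixed `ν`, Galerkin level).
`ledger negatives --problem AnomalousDissipation` (6 statements, 2026-08-17: 14324, 0204, 13037, 2979, 2984, 2859):
none equal or trivially equivalent to either stub (none is a Galerkin-trajectory statement).

## BC3 audit (this seat; raw outputs in the seat's NOTES.md `birth-certificate:`)

`lean check --json birth.lean`: rc 0, `sorries: 2` = the two stubs (`stub_uniformGalerkinAnomaly`,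
`stub_fixedViscosityResolution`), zero elsewhere (`GalerkinFloor_of` sorry-free; `GalerkinFloor_via_stubs`
"proof-of-item … GalerkinFloor (route_item route-AnomalousDissipation-DecimationAxis); NOT closed: axioms [sorryAx]").
Probes (`bc/GalerkinFloor_stub_probes{,_literal}.lean`, stub statements copied verbatim, importing the route file):
`stub → GalerkinFloor` and `stub → AnomalousDissipation` by `first | exact? | simpa [X] | (unfold X; simpa) | aesop`
AND by the literal `first | exact? | simpa | aesop` — all 8 FAIL ("unsolved goals … ⊢ GalerkinFloor /
⊢ AnomalousDissipation", "aesop: failed to prove the goal after exhaustive search"; rc 1, 95 s + 32 s).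

Shape (D-0027 §3.3, as `Cruxes/WindyGalerkinSteadyZerothLaw/Lines/birth.lean`): sorried statements `stub_<name>`
with FULL signatures (registered), by-name handles `Statement.stub_<name> : Prop := type_of% stub_<name>`,
composition `GalerkinFloor_of (hA : Statement.stub_…) (hB : Statement.stub_…) : GalerkinFloor` sorry-free, and
`GalerkinFloor_via_stubs` = the composition applied to the stubs.  §0 names the crux's sub-clauses VERBATIM
(transparent `def`s), so the composition is definitional unfolding.
-/

noncomputable section

-- D-0017: single-problem summit ⇒ the duplicated namespace segment is by design.
set_option linter.dupNamespace false

open Filter Set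
open Literature.Analysis.FunctionSpaces.Torus Literature.Analysis.FluidPDE

namespace Summit.AnomalousDissipation.AnomalousDissipation.Cruxes.GalerkinFloor.Birth

open Summit.AnomalousDissipation.AnomalousDissipation.Theses.DecimationAxis

/-- Lattice frequencies `ℤ³` (local notation). -/
local notation "ℤ³" => Fin 3 → ℤ
/-- Fourier coefficient values `ℂ³` (local notation). -/
local notation "ℂ³" => EuclideanSpace ℂ (Fin 3)

/-! ## §0 Vocabulary — the sub-clauses of `GalerkinFloor`, VERBATIM, given names (transparent `def`s) -/

/-- **Designer force** (the four force clauses of `GalerkinFloor`, verbatim): a real (conjugate-symmetric)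
coefficient family `g`, band-limited to `freqBall N`, without mean mode, transversal (`k · g k = 0`). -/
def IsDesignerForce (N : ℕ) (g : ℤ³ → ℂ³) : Prop :=
  IsConjSymm g ∧ (∀ k, k ∉ freqBall N → g k = 0) ∧ g 0 = 0 ∧
    (∀ k : ℤ³, ∑ i, ((k i : ℤ) : ℂ) * g k i = 0)

/-- **Galerkin trajectory on `S` at viscosity `ν` driven by `g↾S`** (the three solution clauses of
`GalerkinFloor`, verbatim — the solution notion of the tree's `exists_galerkin_solution`): values in the
Galerkin phase space, continuous on `[0, ∞)`, one-sided derivative `galerkinRHS` on every `[0, T]`. -/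
def IsCoeffTrajectory (S : Finset ℤ³) (ν : ℝ) (g : ℤ³ → ℂ³) (c : ℝ → ↥S → ℂ³) : Prop :=
  (∀ t, c t ∈ galerkinSubspace S) ∧ ContinuousOn c (Set.Ici 0) ∧
    (∀ T : ℝ, ∀ t ∈ Set.Icc (0 : ℝ) T,
      HasDerivWithinAt c (galerkinRHS S ν (fun k => g k) (c t)) (Set.Icc 0 T) t)

/-- Kinetic energy `Σ_{k∈S} ‖c_k(t)‖²` (`= ∫|u|²` for `u = realTrigPoly S c̄`; verbatim the crux's functional). -/
def coeffEnergy {S : Finset ℤ³} (c : ℝ → ↥S → ℂ³) : ℝ → ℝ :=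
  fun t => ∑ k : ↥S, ‖c t k‖ ^ 2

/-- TOTAL dissipation rate `ν‖∇u(t)‖² = ν·4π²·Σ_{k∈S} |k|²‖c_k(t)‖²` (all modes of `S`). -/
def coeffDissipation {S : Finset ℤ³} (ν : ℝ) (c : ℝ → ↥S → ℂ³) : ℝ → ℝ :=
  fun t => ν * (4 * Real.pi ^ 2 * ∑ k : ↥S, freqNormSq (k : ℤ³) * ‖c t k‖ ^ 2)

/-- RESOLVED dissipation rate at wavenumber `M`: `ν·4π²·Σ_{k∈S, |k|≤M} |k|²‖c_k(t)‖²`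
(verbatim the crux's functional). -/
def coeffResolvedDissipation {S : Finset ℤ³} (ν : ℝ) (M : ℕ) (c : ℝ → ↥S → ℂ³) : ℝ → ℝ :=
  fun t => ν * (4 * Real.pi ^ 2 * ∑ k : ↥S,
    if freqNormSq (k : ℤ³) ≤ (M : ℝ) ^ 2 then freqNormSq (k : ℤ³) * ‖c t k‖ ^ 2 else 0)

/-! ## §1 Registered stubs (the only `sorry`s of the file) -/

/-- **Stub 1 — TRUNCATION-UNIFORM GALERKIN ANOMALY (total dissipation; the `ν → 0` physics; XL, open).**
Some designer force `(N, g)`, budgets `E`, `ε > 0` and positive viscosities `ν_j → 0` such that for every `j`,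
for all sufficiently large truncations `K` (threshold `K₀ = K₀(j)`), SOME trajectory of the exact-coupling Galerkin
system on `S = freqBall K ∖ {0}` at viscosity `ν_j` has `limsup`-mean energy `≤ E` and `liminf`-mean TOTAL
dissipation `ν_j·4π²·Σ_{k∈S}|k|²‖c_k‖² ≥ ε`.  = `GalerkinFloor` with the resolution wavenumber removed (so
`GalerkinFloor ⟹` this); the converged-DNS zeroth law in trajectory form, eventually in `K`.
Why it might fail: no steady band-limited force may have a truncation-uniform plateau (laminar / condensate
branches; planar gravest-mode forcing is Marchioro-rigid at every truncation, in tree).  Sources: KanedaEtAl2003,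
Sreenivasan1998, Frisch1995 §5.2, FoiasManleyRosaTemam2001 Ch. V, DoeringFoias2002 §2; hub stmt-AnomalousDissipation-14283. -/
theorem stub_uniformGalerkinAnomaly :
    ∃ (N : ℕ) (g : ℤ³ → ℂ³), IsDesignerForce N g ∧ ∃ (E ε : ℝ), 0 < ε ∧ ∃ ν : ℕ → ℝ,
      (∀ j, 0 < ν j) ∧ Tendsto ν atTop (nhds 0) ∧
      ∀ j, ∃ K₀ : ℕ, ∀ K, K₀ ≤ K → ∀ S : Finset ℤ³, S = (freqBall K).erase 0 →
        ∃ c : ℝ → ↥S → ℂ³, IsCoeffTrajectory S (ν j) g c ∧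
          longTimeAvgSup (coeffEnergy c) ≤ E ∧ ε ≤ longTimeAvgInf (coeffDissipation (ν j) c) := by
  sorry

/-- **Stub 2 — TRUNCATION-UNIFORM RESOLUTION AT FIXED VISCOSITY (the `K → ∞` analysis; L–XL, open,
regularity-flavoured).**  For every `ν > 0`, designer force `(N, g)`, budgets `E`, `ε` and loss `δ > 0` there is
ONE wavenumber `M` such that for EVERY truncation `K` and EVERY Galerkin trajectory on `freqBall K ∖ {0}` at
viscosity `ν` with `limsup`-mean energy `≤ E` and `liminf`-mean total dissipation `≥ ε`, the `liminf`-mean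
dissipation RESOLVED below `M` is `≥ ε − δ` (no fixed fraction of the time-averaged dissipation escapes to the
truncation scale as `K → ∞`; ⟺ mean energy EQUALITY for Galerkin-limit stationary statistics at `(g, ν)`;
⟸ `MomentParity.ResolvedDissipation` stmt-14284 ⟸ regularity of `NS(ν, realTrigPoly g)`).  Trivially true for
`ε ≤ δ` (resolved dissipation is non-negative) and for `K ≤ M`; the content is `ε > δ`, `K → ∞`.
Why it might fail: intermittent enstrophy / a positive Duchon–Robert defect at positive viscosity forced on loud
trajectories (energy equality known only under Onsager-critical integrability, arXiv:0704.0759); numerically,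
partial thermalisation at `k ~ K` (CichowlasEtAl2005, FrischEtAl2008).  Sources: FoiasManleyRosaTemam2001 Ch. IV
(1.31)–(1.33), (3.6); FoiasGuillopeTemam1981; FoiasRosaTemam2019 §4; DuchonRobert2000; hub stmt-14284 / -14330 +
`Cruxes/ResolvedDissipation/WhyItResists.md`, `Cruxes/UniformResolution/Disproof.lean`. -/
theorem stub_fixedViscosityResolution :
    ∀ ν : ℝ, 0 < ν → ∀ (N : ℕ) (g : ℤ³ → ℂ³), IsDesignerForce N g → ∀ (E ε δ : ℝ), 0 < δ →
      ∃ M : ℕ, ∀ (K : ℕ) (S : Finset ℤ³), S = (freqBall K).erase 0 →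
        ∀ c : ℝ → ↥S → ℂ³, IsCoeffTrajectory S ν g c →
          longTimeAvgSup (coeffEnergy c) ≤ E → ε ≤ longTimeAvgInf (coeffDissipation ν c) →
            ε - δ ≤ longTimeAvgInf (coeffResolvedDissipation ν M c) := by
  sorry

/-! ## §2 By-name handles of the registered stubs (hypotheses of the composition; D-0027 §3.3 shape) -/

/-- Statement of registered stub 1 (`stub_uniformGalerkinAnomaly`), by name. -/
def Statement.stub_uniformGalerkinAnomaly : Prop :=
  type_of% _root_.Summit.AnomalousDissipation.AnomalousDissipation.Cruxes.GalerkinFloor.Birth.stub_uniformGalerkinAnomaly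

/-- Statement of registered stub 2 (`stub_fixedViscosityResolution`), by name. -/
def Statement.stub_fixedViscosityResolution : Prop :=
  type_of% _root_.Summit.AnomalousDissipation.AnomalousDissipation.Cruxes.GalerkinFloor.Birth.stub_fixedViscosityResolution

/-! ## §3 Composition (kernel-checked; no `sorry` outside the two stubs) -/

/-- **The skeleton closes the crux BY NAME**:
`stub_uniformGalerkinAnomaly → stub_fixedViscosityResolution → DecimationAxis.GalerkinFloor`.
Keep the heart's `(N, g, E, ν)` and take `ε/3` as the crux's floor parameter; at level `j` the truncation
threshold `K₀` comes from stub 1 and the resolution wavenumber `M` from stub 2 at `(ν j, N, g, E, ε, δ := ε/3)`;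
for `K ≥ K₀` the stub-1 trajectory meets stub 2's premises verbatim and `ε − ε/3 = 2·(ε/3)`. -/
theorem GalerkinFloor_of (hA : Statement.stub_uniformGalerkinAnomaly)
    (hB : Statement.stub_fixedViscosityResolution) : GalerkinFloor := by
  obtain ⟨N, g, hg, E, ε, hε, ν, hν, hlim, hAj⟩ := hA
  obtain ⟨hs, hsupp, hg0, htr⟩ := hg
  refine ⟨N, g, hs, hsupp, hg0, htr, E, ε / 3, by positivity, ν, hν, hlim, fun j => ?_⟩
  obtain ⟨K₀, hK₀⟩ := hAj j
  obtain ⟨M, hM⟩ := hB (ν j) (hν j) N g ⟨hs, hsupp, hg0, htr⟩ E ε (ε / 3) (by positivity)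
  refine ⟨M, K₀, fun K hK S hS => ?_⟩
  obtain ⟨c, hc, hE, hD⟩ := hK₀ K hK S hS
  obtain ⟨h1, h2, h3⟩ := hc
  have hres : ε - ε / 3 ≤ longTimeAvgInf (coeffResolvedDissipation (ν j) M c) :=
    hM K S hS c ⟨h1, h2, h3⟩ hE hD
  have h23 : 2 * (ε / 3) = ε - ε / 3 := by ring
  refine ⟨c, h1, h2, h3, hE, ?_⟩
  rw [h23]
  exact hres

/-- The composition applied to the (sorried) stubs: the pipeline closes the crux by name (sorries only
upstream, inside the two registered stubs). -/
theorem GalerkinFloor_via_stubs : GalerkinFloor :=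
  GalerkinFloor_of stub_uniformGalerkinAnomaly stub_fixedViscosityResolution

end Summit.AnomalousDissipation.AnomalousDissipation.Cruxes.GalerkinFloor.Birth

end
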